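import Mathlib

/-!
# Zhang (2022): the exponent layer as a linear system — admissible `A`, binding rows

Trunk T-ANT (NumberTheory/LFunctions). Y. Zhang, *Discrete mean estimates and the Landau–Siegel
zero*, arXiv:2211.02515v1 (2022) [Zhang2022LandauSiegel], §§2–4, (7.5), (14.3).
**Status of the source: an unrefereed manuscript, a claimed result under adjudication** (audit +
repair census of arXiv:2211.02515; no claim about Landau–Siegel is made here).

The manuscript's parameters are powers of `𝓛 = log D`: hypothesis (A) `L(1,χ) < 𝓛^{-A}`
(`A = 2022`), `P = exp 𝓛⁹`, prime window `𝓛⁻⁶⁸` (so `𝔓 ≍ P²𝓛⁻⁷⁷`, (2.9)), `t₀ = 𝓛⁵¹⁹`,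
`𝓛₁ = 𝓛⁴⁰⁵`, `𝓛₂ = 𝓛⁴⁰⁰`, the thresholds `𝓛¹¹⁷¹`, `𝓛⁻⁵⁸⁵`, `𝓛⁻⁶³³` of (3.4)–(3.6), the bound
`|F| + |G| ≪ 𝓛⁷⁹` of Lemma 4.1, and `#Ψ₂ ≪ 𝔓𝓛^{-E}`, `E = 739` (Prop. 2.1). Every step of
§§3–4 and the two uses (7.5)/(14.3) of Prop. 2.1 needs a LINEAR inequality between these
exponents [pp. 7–9, 13, 29 of the source]; with the contour radius `α* = 𝓛^{-(A+2)}` of Lemma 3.1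
(optimal, cf. `Section2Assembly.lemma31_residue_exponents`) the `A`-dependent rows are

* (3.4): `E ≤ 2·1171 − 1602` (`= 740`, `Section3ExceptionalSet.lemma34_exponent`);
* (3.5) ← Lemma 3.1: `E ≤ A − 2 − 4·9 − 68 − 2·585` (`= A − 1276`; the text prints `−1909` for
  `−1916` and records `739`, `lemma35_moment_exponent`);
* (3.6) ← Lemma 3.2: `E ≤ A − 17 − 2·633` (`= A − 1283`, `lemma36_exponent`);
* (7.5)/(14.3) (Hölder with `(∑τ₅²/m)^{1/2}(∑τ₂²/m)^{1/4}(#Ψ₂)^{1/4}`): `E > 3·68 + 57·9 = 717`.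

This file PROVES the elementary linear-arithmetic facts behind the cell's binding-constraint map
(sweep seat 2, `HOME/sweep/sweep-2/BINDING-MAP.md`, inventory "sweep-2 interim v0"):
(i) with the secondary exponents as printed, the `A`-rows are satisfiable iff `A > 2000`, the
binding pair being {(3.6) ← Lemma 3.2, (7.5)/(14.3)} (`admissibleA_iff`; `2022` has slack `22` in
`E`, i.e. `𝓛^{5.5}` in the final exponent of (7.5)); (ii) re-optimising also the thresholds of
(3.4)–(3.6) and the `F`-bound (Lemmas 4.1, 4.2, (4.10) rows added) cannot go below
`A = 36191/20 = 1809.55`, the binding chain being (3.4) → Lemma 4.1 → (4.10) → (3.5) → (7.5)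
(`lt_of_admissibleThresholds`, with a witness at `A = 1810`); (iii) the printed point satisfies
every inventoried row (`admissibleSkeleton_printed`), and over the whole fourteen-variable
skeleton `A > 1039099/1880 ≈ 552.7` (`lt_of_admissibleSkeleton`) — a LOWER BOUND FOR THE SKELETON
ONLY: the text absorbs `O(1)` and `log 𝓛` factors into integer exponents and several `o(1)`'s impose
floors that are not all inventoried, so (iii) says nothing about what a careful re-optimisation of
the method could reach. None of this bears on the cell's verdict: the main-term constants of
§§8–18 contain no exponent of this layer (the closing inequality fails for every `A`,
`Section2AllIota.not_mainOrderContradictionG_all`). No statement about Theorems 1–2 of the source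
is made or implied.
-/

namespace Literature.NumberTheory.LFunctions.Zhang2022.ExponentLayer

/-! ### Regime (a): secondary exponents printed, `A` and `E` free -/

/-- The `A`-dependent rows of the exponent layer with all secondary exponents at their printed
values (`e_P = 9`, window `68`, thresholds `1171, 585, 633`): `E` is the exponent of Prop. 2.1.
[cite: Zhang2022LandauSiegel, §3 and (7.5)] -/
def AdmissibleA (A E : ℝ) : Prop :=
  E ≤ 2 * 1171 - 1602 ∧                 -- (3.4)
  E ≤ A - 2 - 4 * 9 - 68 - 2 * 585 ∧    -- (3.5) via Lemma 3.1, α* = 𝓛^{-(A+2)}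
  E ≤ A - 17 - 2 * 633 ∧                -- (3.6) via Lemma 3.2
  (3 * 68 + 57 * 9 : ℝ) < E             -- (7.5)/(14.3): E > 3·68 + 57·9 = 717

/-- The printed point `A = 2022`, `E = 739`. [cite: Zhang2022LandauSiegel, (2.10)] -/
theorem admissibleA_printed : AdmissibleA 2022 739 := by
  norm_num [AdmissibleA]

/-- Farkas certificate of regime (a): rows (3.6) and (7.5) with multipliers `1, 1` give
`A > 17 + 2·633 + 3·68 + 57·9 = 2000`. [folklore] -/
theorem lt_of_admissibleA {A E : ℝ} (h : AdmissibleA A E) : 2000 < A := by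
  obtain ⟨-, -, h₃, h₄⟩ := h
  linarith

/-- Regime (a) exactly: admissible iff `A > 2000` (witness `E = min 740 (A − 1283)`). [folklore] -/
theorem admissibleA_iff (A : ℝ) : (∃ E, AdmissibleA A E) ↔ 2000 < A := by
  constructor
  · rintro ⟨E, h⟩
    exact lt_of_admissibleA h
  · intro hA
    refine ⟨min 740 (A - 1283), ?_, ?_, ?_, ?_⟩
    · exact (min_le_left _ _).trans (by norm_num)
    · exact (min_le_right _ _).trans (by linarith)
    · exact (min_le_right _ _).trans (by linarith)
    · exact lt_min (by norm_num) (by linarith)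

/-- The smallest admissible integer: `A = 2001` with `E = 718` (slack `1/4` of a power of `𝓛` in
the final exponent `(E+77)/4 − 198.5` of (7.5)). [folklore] -/
theorem admissibleA_2001 : AdmissibleA 2001 718 := by
  norm_num [AdmissibleA]

/-- … and `A = 2000` is not admissible for any `E`. [folklore] -/
theorem not_admissibleA_2000 (E : ℝ) : ¬ AdmissibleA 2000 E := fun h => by
  have := lt_of_admissibleA h
  norm_num at this

/-! ### Regime (a2): the thresholds of (3.4)–(3.6), the `F`-bound and `E` free as well -/

/-- Rows of Lemma 4.1 (`|F|²⁰ ≪ 𝓛^{405+1}·𝓛^{h₄}` hence `|F| ≪ 𝓛^{g}` needs `406 + h₄ ≤ 20g`),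
Lemma 4.2 (`FG = 1 + O(𝓛^{-(h₆−406)})` needs `h₆ > 406`), (4.8)/(4.10)
(`𝔄 = 1 + 𝔅 + O(𝓛^{-(h₅−405−1−g)})` must be `o(α) = o(𝓛⁻⁹)`), (7.5)/(14.3), and (3.4)–(3.6) with
free thresholds `h₄, h₅, h₆`; `e_P = 9`, window `68`, `𝓛₁ = 𝓛⁴⁰⁵` printed.
[cite: Zhang2022LandauSiegel, Lemmas 3.4–3.6, 4.1, 4.2, 4.4, (4.10), (7.5)] -/
def AdmissibleThresholds (A E h₄ h₅ h₆ g : ℝ) : Prop :=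
  405 + 1 + h₄ ≤ 20 * g ∧               -- Lemma 4.1
  (405 + 1 : ℝ) < h₆ ∧                  -- Lemma 4.2
  (9 : ℝ) < h₅ - 405 - 1 - g ∧          -- (4.10): 100 > 9 at the printed point
  (3 * 68 + 57 * 9 : ℝ) < E ∧           -- (7.5)/(14.3)
  E ≤ 2 * h₄ - 1602 ∧                   -- (3.4)
  E ≤ A - 2 - 4 * 9 - 68 - 2 * h₅ ∧     -- (3.5)
  E ≤ A - 17 - 2 * h₆                   -- (3.6)

/-- The printed point `(A, E, h₄, h₅, h₆, g) = (2022, 739, 1171, 585, 633, 79)`.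
[cite: Zhang2022LandauSiegel, §§2–4] -/
theorem admissibleThresholds_printed : AdmissibleThresholds 2022 739 1171 585 633 79 := by
  norm_num [AdmissibleThresholds]

/-- Farkas certificate of regime (a2): multipliers `1/10, 2, 21/20, 1/20, 1` on the rows
Lemma 4.1, (4.10), (7.5), (3.4), (3.5) give `A > 36191/20 = 1809.55`; the binding chain is
(3.4) → Lemma 4.1 → (4.10) → (3.5) → (7.5), not the (3.6)-row. [folklore] -/
theorem lt_of_admissibleThresholds {A E h₄ h₅ h₆ g : ℝ} (h : AdmissibleThresholds A E h₄ h₅ h₆ g) :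
    (36191 / 20 : ℝ) < A := by
  obtain ⟨h₁, -, h₃, h₇, h₈, h₉, -⟩ := h
  linarith

/-- A witness just above the bound: `A = 1810` is admissible in regime (a2). [folklore] -/
theorem admissibleThresholds_1810 :
    AdmissibleThresholds 1810 (7171 / 10) (23191 / 20) (4933 / 10) 407 (1957 / 25) := by
  norm_num [AdmissibleThresholds]

/-! ### The fourteen-variable skeleton (inventory "sweep-2 interim v0") -/

/-- All inventoried rows of the exponent layer (ids L01–L16 of the cell's interim inventory), in
the variables `A`, `e_P` (`P = exp 𝓛^{e_P}`), `w` (prime window `𝓛^{-w}`), `t` (`t₀ = 𝓛^t`),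
`l₁, l₂` (`𝓛₁, 𝓛₂`), `k₁` (contour cut `|v| < 𝓛^{k₁}`), `k₂` (`ω₁(w) = exp(w²/4𝓛^{k₂})`),
`h₄, h₅, h₆` (thresholds of (3.4)–(3.6)), `g` (Lemma 4.1), `E` (Prop. 2.1), `e_T` (`T = exp 𝓛^{e_T}`).
SKELETON ONLY: the text absorbs bounded and `log 𝓛` factors into these integers and imposes further
`o(1)`-floors that are not all listed (row L16, `e_P > 3` from Lemma 5.8, is one example of such a
floor; without the sign row L00 `0 ≤ k₂` the system is unbounded below in `A`).
[cite: Zhang2022LandauSiegel, §§2–5, Lemma 8.1, §11, (13.11), (15.4)] -/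
def AdmissibleSkeleton (A eP w t l₁ l₂ k₁ k₂ h₄ h₅ h₆ g E eT : ℝ) : Prop :=
  0 ≤ k₂ ∧                                        -- L00  sign convention: ω₁ = Gaussian of variance 2𝓛^{k₂} ≥ 2
  l₁ + 1 + h₄ ≤ 20 * g ∧                          -- L01  Lemma 4.1
  l₁ + 1 < h₆ ∧                                   -- L02  Lemma 4.2
  eP < h₅ - l₁ - 1 - g ∧                           -- L03  (4.10) = o(α)
  eP < 2 * k₁ - k₂ ∧                               -- L04  ε = exp(−c𝓛^{2k₁−k₂}) beats P^{O(1)}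
  eP < 2 * (l₁ - l₂) ∧                             -- L05  ω off the window beats P^{O(1)}
  w + eP < t - l₁ - 4 * eP ∧                       -- L06  Lemma 8.1 (114 − 36 = 78 > 77)
  3 * w + 57 * eP < E ∧                            -- L07  (7.5)/(14.3)
  E ≤ 2 * h₄ - 1602 ∧                              -- L08a (3.4)
  E ≤ A - 2 - 4 * eP - w - 2 * h₅ ∧                -- L08b (3.5) via Lemma 3.1
  E ≤ A - 17 - 2 * h₆ ∧                            -- L08c (3.6) via Lemma 3.2
  k₂ / 2 + 7 / 2 * eP + 3 * eT < w ∧               -- L09  (13.11)(c)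
  k₁ + 7 / 2 * eP + 3 / 2 * eT < w ∧               -- L09b (13.11)(c), second bookkeeping
  k₂ + 4 * eP < 2 * w ∧                            -- L10  §11 E₂-mean
  1 < eT ∧ eT < eP ∧                               -- L11  T = exp 𝓛^{e_T}
  w / 2 + 11 / 2 * eP < t - l₁ ∧                   -- L12  (15.4)
  306 / 100 * t - 4 * l₂ ≤ -eP ∧                   -- L13  Lemma 5.3
  5 / 2 * eP + 3 * eT < t - l₁ ∧                   -- L14  (13.11)(b)
  k₁ ≤ w ∧                                         -- L15  (5.2)/(5.4)
  3 < eP                                           -- L16  Lemma 5.8 floor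

/-- The printed exponent vector satisfies every inventoried row (margins, smallest first:
L08c `0` (definition of `E`), L11a `1/10`, L04 `1`, L05 `1`, L06 `1`, L08a `1`, L13 `2.86`, …).
[cite: Zhang2022LandauSiegel, §2] -/
theorem admissibleSkeleton_printed :
    AdmissibleSkeleton 2022 9 68 519 405 400 20 30 1171 585 633 79 739 (11 / 10) := by
  norm_num [AdmissibleSkeleton]

/-- Exact-rational LP over the skeleton: `A > 1039099/1880 ≈ 552.71` for every admissible vector
(Farkas support: L00, L01, L03, L04, L05, L06, L07, L08a, L08b, L09b, L11a, L13, L16). A lower bound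
for the SKELETON, not a statement about the method. [folklore] -/
theorem lt_of_admissibleSkeleton {A eP w t l₁ l₂ k₁ k₂ h₄ h₅ h₆ g E eT : ℝ}
    (h : AdmissibleSkeleton A eP w t l₁ l₂ k₁ k₂ h₄ h₅ h₆ g E eT) : (1039099 / 1880 : ℝ) < A := by
  obtain ⟨h00, h01, h02, h03, h04, h05, h06, h07, h08a, h08b, h08c, h09, h09b, h10, h11a, h11b, h12,
    h13, h14, h15, h16⟩ := h
  linarith

/-- An admissible skeleton vector with `A = 69017/94 + 1 ≈ 735.2` (every strict row by at least a
full power of `𝓛` except `e_T > 1`). [folklore] -/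
theorem admissibleSkeleton_witness :
    AdmissibleSkeleton (69017 / 94 + 1) 4 19 (8700 / 47) (6820 / 47) (13405 / 94) (5 / 2) 0 944
      (38655 / 188) (40535 / 188) (10247 / 188) 286 (101 / 100) := by
  norm_num [AdmissibleSkeleton]

end Literature.NumberTheory.LFunctions.Zhang2022.ExponentLayer
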